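import Summits.Ventures.HSemireg.PhaseTorusLaw7

/-!
# Phase-torus law on `(μ₄)⁴` at corank `≤ γ`: the graded statement `PhaseTorusLawN γ`, and the NO at all coranks —
# the corank-16 witness `ω₁₆ = 16·𝟙_L − 1 + Re χ₁₁₁₁` (HSemireg support file; phase-torus line, corank threshold, module 1 of 2)

Crux of record: `Summit.HodgeConjecture.HodgeConjecture.Theses.EightfoldBlochSeeds.BlochSeedDiscOne`
(= `HasHyperbolicBlochSeed 4 1`, item stmt-HodgeConjecture-18881; skeleton `Lines/birth.lean`, STUB R `stub_rung_pad4_seedAt`,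
named technique = PAD-4 two-level ⊕-block design with a TWO-TERM line-bundle presentation).
Nothing in this file proves HC, HC_AV, HC_CM, H2 or item 18881; census-neutral (no SAT∕UNSAT row is added or changed).

WHAT THIS FILE IS (tree copy of §1–§4 of the crux workfile `Cruxes/BlochSeedDiscOne/PhaseTorusLawAllCoranks.lean` b3a30e3be1a62a1c,
author s4-prove-2 g0, director-hodge R19.171 block F1 «PHASE-TORUS LAW at ALL coranks — remove the ≤ 7 bound»; statements verbatim,
the local character calculus `u4…` of the workfile replaced by the tree's `e…` of `PhaseTorusLaw.lean` (`u4 = e` by `rfl`);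
pen + stdlib numerics: `Cruxes/BlochSeedDiscOne/PHASE-TORUS-ALLCORANK-s4p2.md` f9de3e256e8a2f46):
* §1 `PhaseTorusLawN γ` — the phase-torus law with positive set of size `≤ γ` (`γ = 4` is `PhaseTorusLaw` and `γ = 7` is
  `PhaseTorusLaw7`, both by `Iff.rfl`; `phaseTorusLawN_four`, `phaseTorusLawN_seven` from the tree theorems `phaseTorusLaw_holds`,
  `phaseTorusLaw7_holds`), monotone in `γ` (`phaseTorusLawN_mono`); the corank-free form `PhaseTorusLawAll ↔ ∀ γ, PhaseTorusLawN γ`.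
* §2 character sums: `Σ_s i^{js} = 4·[j = 0]` (`charSum_e`), `Σ_τ χ_k(τ) = 256·[k = 0]` (`sum_chi`), `χ_k χ_{k'} = χ_{k+k'}`.
* §3 the EVEN SUBLATTICE `L = 2·(ℤ/4)⁴` (`evenSet`, 16 phases, `L^⊥ = L`): `Σ_{τ ∈ L} χ_k(τ) = 16·[k ∈ L]` (`sum_chi_evenSet`).
* §4 **THE LAW FAILS FROM CORANK 16 ON**: the integer measure `ω₁₆ = 16·𝟙_L − 1 + Re χ₁₁₁₁` is `≤ 0` off `L` (`omega16_nonpos`),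
  all its 79 clean moments vanish (`moment_omega16_clean`) and its top moment is `128` (`moment_omega16_top`); hence
  `not_phaseTorusLawN_sixteen`, `not_phaseTorusLawN_of_le` (every `γ ≥ 16`), `not_phaseTorusLawAll`.  So NO corank-uniform
  argument (covering-lemma induction, character sum uniform in the corank) exists; with `phaseTorusLawN_seven` the critical
  corank `γ*` (least `γ` at which the law fails) satisfies `8 ≤ γ* ≤ 16` from this file alone (the sequel sharpens the lower end).
Everything here is PROVED (axioms `propext`, `Classical.choice`, `Quot.sound`; no `sorry`, no named fact, no instance, no notation).

WHAT IT IS NOT: a statement about sheaves, monads, the semi-homogeneous alphabet, a SOURCE or a SEED.  `PhaseTorusLawN γ` is the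
torus-form hypothesis `hPT` of the design-level UP law `Pad4TowerLinePhaseTorus.lineTwoTermUp_mu_eq_zero_of_law γ` (corank
`Σ m_N − Σ m_P ≤ γ` of ONE presentation class, two-term LINE designs); the NO at corank 16 says that route is closed beyond the
threshold, nothing more.  The E8 law, the box law at every size and corank 8 (`phaseTorusLaw8_holds`) are the sequel
`PhaseTorusLawE8`; the μ-lattice ∕ corank-10 box law is `PhaseTorusBoxLaw`.
Tree filing: hsemireg-phasetorus-typer-1 g2.
-/

namespace Summit.Ventures.HSemireg.PhaseTorus

open Finset BigOperators

/-! ## §1 The law at corank `≤ γ`; monotonicity; the corank-free form -/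

/-- **phase-torus law at corank `≤ γ`** (`γ = 4`: `PhaseTorusLaw` by `rfl`; `γ = 7`: `PhaseTorusLaw7` by `rfl`). -/
def PhaseTorusLawN (γ : ℕ) : Prop :=
  ∀ (ω : PT → ℝ) (A : Finset PT), A.card ≤ γ → (∀ τ, τ ∉ A → ω τ ≤ 0) →
    (∀ k, KAdm k → moment ω k = 0) → moment ω (fun _ => 1) = 0

/-- the corank-free («all coranks») form: no cardinality bound on the positive set. -/
def PhaseTorusLawAll : Prop :=
  ∀ (ω : PT → ℝ) (A : Finset PT), (∀ τ, τ ∉ A → ω τ ≤ 0) →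
    (∀ k, KAdm k → moment ω k = 0) → moment ω (fun _ => 1) = 0

/-- monotone in the corank bound. -/
theorem phaseTorusLawN_mono {γ γ' : ℕ} (h : γ' ≤ γ) (H : PhaseTorusLawN γ) : PhaseTorusLawN γ' :=
  fun ω A hA hω hK => H ω A (hA.trans h) hω hK

/-- `PhaseTorusLawN 4` IS `PhaseTorusLaw`. -/
theorem phaseTorusLawN_four_iff : PhaseTorusLawN 4 ↔ PhaseTorusLaw := Iff.rfl

/-- `PhaseTorusLawN 7` IS `PhaseTorusLaw7`. -/
theorem phaseTorusLawN_seven_iff : PhaseTorusLawN 7 ↔ PhaseTorusLaw7 := Iff.rfl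

/-- corank `≤ 4` (`PhaseTorusLawProof.phaseTorusLaw_holds`). -/
theorem phaseTorusLawN_four : PhaseTorusLawN 4 := phaseTorusLaw_holds

/-- corank `≤ 7` (`PhaseTorusLaw7.phaseTorusLaw7_holds`, the sharp BOX-covering range). -/
theorem phaseTorusLawN_seven : PhaseTorusLawN 7 := phaseTorusLaw7_holds

/-- the corank-free law is the conjunction of all finite-corank laws. -/
theorem phaseTorusLawAll_iff : PhaseTorusLawAll ↔ ∀ γ, PhaseTorusLawN γ :=
  ⟨fun H _ ω A _ hω hK => H ω A hω hK, fun H ω A hω hK => H A.card ω A le_rfl hω hK⟩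

/-! ## §2 Character sums (over the tree's `e s = i ^ s`, `chi k τ = e (Σ_f k_f τ_f)`) -/

/-- `chi k τ = e (Σ_f k_f τ_f)` (definitional). -/
theorem chi_eq_e (k τ : PT) : chi k τ = e (∑ f, k f * τ f) := rfl

/-- one-coordinate character sum: `Σ_s i^{js} = 4·[j = 0]`. -/
theorem charSum_e (j : ZMod 4) : ∑ s : ZMod 4, e (j * s) = if j = 0 then 4 else 0 := by
  rcases (by decide : ∀ x : ZMod 4, x = 0 ∨ x = 1 ∨ x = 2 ∨ x = 3) j with rfl | rfl | rfl | rfl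
  · rw [if_pos rfl, sum_univ_zmod4]; simp only [zero_mul, e_zero]; norm_num
  · rw [if_neg (by decide), sum_univ_zmod4, mul_zero, mul_one, (by decide : (1 : ZMod 4) * 2 = 2),
      (by decide : (1 : ZMod 4) * 3 = 3), e_zero, e_one, e_two, e_three]; ring
  · rw [if_neg (by decide), sum_univ_zmod4, mul_zero, mul_one, (by decide : (2 : ZMod 4) * 2 = 0),
      (by decide : (2 : ZMod 4) * 3 = 2), e_zero, e_two]; ring
  · rw [if_neg (by decide), sum_univ_zmod4, mul_zero, mul_one, (by decide : (3 : ZMod 4) * 2 = 2),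
      (by decide : (3 : ZMod 4) * 3 = 1), e_zero, e_one, e_two, e_three]; ring

/-- full character sum: `Σ_τ χ_k(τ) = 256·[k = 0]`. -/
theorem sum_chi (k : PT) : ∑ τ : PT, chi k τ = if k = 0 then 256 else 0 := by
  have h : ∑ τ : PT, chi k τ = ∏ f, ∑ s : ZMod 4, e (k f * s) := by
    simp_rw [chi_eq_prod_e]
    rw [Finset.prod_univ_sum]
    simp only [Fintype.piFinset_univ]
  rw [h]
  by_cases hk : k = 0
  · subst hk
    rw [if_pos rfl, Finset.prod_congr rfl fun f _ => by rw [charSum_e, if_pos (Pi.zero_apply _)]]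
    simp; norm_num
  · rw [if_neg hk]
    obtain ⟨f, hf⟩ : ∃ f, k f ≠ 0 := by
      by_contra hne; push Not at hne; exact hk (funext hne)
    exact Finset.prod_eq_zero (Finset.mem_univ f) (by rw [charSum_e, if_neg hf])

/-- shifted character: `χ_k(τ) χ_{k'}(τ) = χ_{k+k'}(τ)`. -/
theorem chi_mul_chi (k k' τ : PT) : chi k τ * chi k' τ = chi (k + k') τ := by
  rw [chi_eq_e, chi_eq_e, chi_eq_e, ← e_add]
  congr 1
  rw [← Finset.sum_add_distrib]
  exact Finset.sum_congr rfl fun f _ => by rw [Pi.add_apply, add_mul]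

/-! ## §3 The even sublattice `L = 2·(ℤ/4)⁴` and its character sums -/

/-- the EVEN SUBLATTICE `L = 2·(ℤ/4)⁴`: all four phase exponents in `{0, 2}` (16 phases; self-dual: `L^⊥ = L`). -/
def evenSet : Finset PT := Fintype.piFinset fun _ : Fin 4 => ({0, 2} : Finset (ZMod 4))

/-- membership in `L`: every coordinate is `0` or `2`. -/
theorem mem_evenSet {τ : PT} : τ ∈ evenSet ↔ ∀ f, τ f = 0 ∨ τ f = 2 := by
  simp [evenSet, Fintype.mem_piFinset]

/-- `|L| = 16`. -/
theorem evenSet_card : evenSet.card = 16 := by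
  rw [evenSet, Fintype.card_piFinset]
  simp [Finset.card_pair (show (0 : ZMod 4) ≠ 2 by decide)]

/-- the two-point character sum over `{0, 2}`: `i^{j·0} + i^{j·2} = 2·[j even]`. -/
theorem pairSum_e (j : ZMod 4) : e (j * 0) + e (j * 2) = if j = 0 ∨ j = 2 then 2 else 0 := by
  rcases (by decide : ∀ x : ZMod 4, x = 0 ∨ x = 1 ∨ x = 2 ∨ x = 3) j with rfl | rfl | rfl | rfl
  · rw [if_pos (Or.inl rfl), mul_zero, zero_mul, e_zero]; norm_num
  · rw [if_neg (by decide), mul_zero, (by decide : (1 : ZMod 4) * 2 = 2), e_zero, e_two]; norm_num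
  · rw [if_pos (Or.inr rfl), mul_zero, (by decide : (2 : ZMod 4) * 2 = 0), e_zero]; norm_num
  · rw [if_neg (by decide), mul_zero, (by decide : (3 : ZMod 4) * 2 = 2), e_zero, e_two]; norm_num

/-- character sum over `L`: `Σ_{τ ∈ L} χ_k(τ) = 16·[k ∈ L]` (so `16·𝟙_L = Σ_{δ ∈ L} χ_δ`). -/
theorem sum_chi_evenSet (k : PT) : ∑ τ ∈ evenSet, chi k τ = if k ∈ evenSet then 16 else 0 := by
  have h : ∑ τ ∈ evenSet, chi k τ = ∏ f, ∑ s ∈ ({0, 2} : Finset (ZMod 4)), e (k f * s) := by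
    simp_rw [chi_eq_prod_e]
    rw [Finset.prod_univ_sum]
    rfl
  have h2 : ∀ f, ∑ s ∈ ({0, 2} : Finset (ZMod 4)), e (k f * s) = if k f = 0 ∨ k f = 2 then 2 else 0 := fun f => by
    rw [Finset.sum_pair (show (0 : ZMod 4) ≠ 2 by decide), pairSum_e]
  rw [h]
  simp_rw [h2]
  by_cases hk : k ∈ evenSet
  · rw [if_pos hk]
    rw [mem_evenSet] at hk
    rw [Finset.prod_congr rfl fun f _ => if_pos (hk f)]
    simp; norm_num
  · rw [if_neg hk]
    rw [mem_evenSet] at hk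
    push Not at hk
    obtain ⟨f, hf⟩ := hk
    exact Finset.prod_eq_zero (Finset.mem_univ f) (by rw [if_neg (not_or.mpr hf)])

/-! ## §4 The corank-16 witness `ω₁₆ = 16·𝟙_L − 1 + Re χ₁₁₁₁` -/

/-- `Re(i^{|τ|})` as a complex number is `(χ₁₁₁₁(τ) + χ₃₃₃₃(τ))/2`. -/
theorem re_e_total (τ : PT) :
    (((e (∑ f, τ f)).re : ℝ) : ℂ) = (chi (fun _ => 1) τ + chi (fun _ => 3) τ) / 2 := by
  rw [Complex.re_eq_add_conj, ← e_neg, chi_eq_e, chi_eq_e]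
  congr 3
  · exact Finset.sum_congr rfl fun f _ => (one_mul _).symm
  · rw [← Finset.sum_neg_distrib]
    exact Finset.sum_congr rfl fun f _ => by rw [show (3 : ZMod 4) = -1 from by decide, neg_one_mul]

/-- **the witness** `ω₁₆(τ) = 16·[τ ∈ L] − 1 + Re(i^{|τ|})` (integer values: `14, 16` on `L`, `0, −1, −2` off `L`). -/
noncomputable def omega16 (τ : PT) : ℝ := 16 * (if τ ∈ evenSet then 1 else 0) - 1 + (e (∑ f, τ f)).re

/-- `ω₁₆ ≤ 0` off the 16 even phases. -/
theorem omega16_nonpos (τ : PT) (hτ : τ ∉ evenSet) : omega16 τ ≤ 0 := by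
  unfold omega16
  rw [if_neg hτ]
  have h1 : (e (∑ f, τ f)).re ≤ 1 := by
    refine (Complex.re_le_norm _).trans ?_
    rw [norm_e]
  linarith

/-- **all moments of `ω₁₆`**: `16·Σ_{L} χ_k − Σ χ_k + ½(Σ χ_{k+1111} + Σ χ_{k+3333})`, evaluated by §2–§3. -/
theorem moment_omega16 (k : PT) : moment omega16 k =
    16 * (if k ∈ evenSet then 16 else 0) - (if k = 0 then 256 else 0) +
      ((if (fun _ => (1 : ZMod 4)) + k = 0 then 256 else 0) + (if (fun _ => (3 : ZMod 4)) + k = 0 then 256 else 0)) / 2 := by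
  have hL : ∑ τ : PT, ((if τ ∈ evenSet then (1 : ℝ) else 0 : ℝ) : ℂ) * chi k τ = if k ∈ evenSet then 16 else 0 := by
    rw [← sum_chi_evenSet, ← Finset.univ_inter evenSet, ← Finset.sum_ite_mem, Finset.univ_inter]
    refine Finset.sum_congr rfl fun τ _ => ?_
    split_ifs <;> simp
  have hT : ∑ τ : PT, (((e (∑ f, τ f)).re : ℝ) : ℂ) * chi k τ =
      ((if (fun _ => (1 : ZMod 4)) + k = 0 then 256 else 0) + (if (fun _ => (3 : ZMod 4)) + k = 0 then 256 else 0)) / 2 := by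
    simp_rw [re_e_total, div_mul_eq_mul_div, add_mul, chi_mul_chi]
    rw [← Finset.sum_div, Finset.sum_add_distrib, sum_chi, sum_chi]
  unfold moment omega16
  push_cast
  simp_rw [add_mul, sub_mul, Finset.sum_add_distrib, Finset.sum_sub_distrib, mul_assoc, ← Finset.mul_sum, hL, one_mul,
    sum_chi, hT]

/-- an admissible frequency lies in `L` iff it is `0`. -/
theorem kadm_mem_evenSet {k : PT} (hk : KAdm k) : k ∈ evenSet ↔ k = 0 := by
  rw [mem_evenSet]
  constructor
  · intro h; funext f
    rcases h f with e | e
    · exact e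
    · exact absurd e (hk.1 f)
  · rintro rfl f; exact Or.inl rfl

/-- `1111 + k = 0 ↔ k = 3333`. -/
theorem one_add_eq_zero_iff (k : PT) : (fun _ => (1 : ZMod 4)) + k = 0 ↔ k = fun _ => 3 := by
  have key : ∀ x : ZMod 4, 1 + x = 0 ↔ x = 3 := by decide
  constructor
  · intro h; funext f; exact (key _).1 (congr_fun h f)
  · rintro rfl; funext f; exact (key _).2 rfl

/-- `3333 + k = 0 ↔ k = 1111`. -/
theorem three_add_eq_zero_iff (k : PT) : (fun _ => (3 : ZMod 4)) + k = 0 ↔ k = fun _ => 1 := by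
  have key : ∀ x : ZMod 4, 3 + x = 0 ↔ x = 1 := by decide
  constructor
  · intro h; funext f; exact (key _).1 (congr_fun h f)
  · rintro rfl; funext f; exact (key _).2 rfl

/-- the clean moments of `ω₁₆` all vanish. -/
theorem moment_omega16_clean (k : PT) (hk : KAdm k) : moment omega16 k = 0 := by
  rw [moment_omega16, if_neg (mt (one_add_eq_zero_iff k).1 hk.2.2), if_neg (mt (three_add_eq_zero_iff k).1 hk.2.1)]
  by_cases h0 : k = 0
  · rw [if_pos ((kadm_mem_evenSet hk).2 h0), if_pos h0]; norm_num
  · rw [if_neg (mt (kadm_mem_evenSet hk).1 h0), if_neg h0]; norm_num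

/-- the top moment of `ω₁₆` is `128 ≠ 0`. -/
theorem moment_omega16_top : moment omega16 (fun _ => 1) = 128 := by
  rw [moment_omega16]
  have h1 : ((fun _ => (1 : ZMod 4)) : PT) ∉ evenSet := by
    rw [mem_evenSet]; intro h; rcases h 0 with e | e <;> exact absurd e (by decide)
  have h2 : ((fun _ => (1 : ZMod 4)) : PT) ≠ 0 := fun h => absurd (congr_fun h 0) (by decide)
  have h3 : ¬ ((fun _ => (1 : ZMod 4)) + (fun _ => (1 : ZMod 4)) : PT) = 0 := fun h => absurd (congr_fun h 0) (by decide)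
  have h4 : ((fun _ => (3 : ZMod 4)) + (fun _ => (1 : ZMod 4)) : PT) = 0 := by
    funext f; show (3 : ZMod 4) + 1 = 0; decide
  rw [if_neg h1, if_neg h2, if_neg h3, if_pos h4]
  norm_num

/-- **THE LAW FAILS AT CORANK 16**: `ω₁₆` is non-positive off the 16 even phases, all its clean moments vanish, and its top
moment is `128`.  So no «covering-lemma induction» and no «character-sum argument uniform in the corank» can exist. -/
theorem not_phaseTorusLawN_sixteen : ¬ PhaseTorusLawN 16 := by
  intro H
  have h := H omega16 evenSet (by rw [evenSet_card]) omega16_nonpos moment_omega16_clean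
  rw [moment_omega16_top] at h
  norm_num at h

/-- … hence at every corank `γ ≥ 16`. -/
theorem not_phaseTorusLawN_of_le {γ : ℕ} (h : 16 ≤ γ) : ¬ PhaseTorusLawN γ :=
  fun H => not_phaseTorusLawN_sixteen (phaseTorusLawN_mono h H)

/-- **the corank-free phase-torus law is false.** -/
theorem not_phaseTorusLawAll : ¬ PhaseTorusLawAll :=
  fun H => not_phaseTorusLawN_sixteen (phaseTorusLawAll_iff.1 H 16)

/-- the threshold bracket from this file: the law holds at every corank `≤ 7` and fails at every corank `≥ 16`. -/
theorem threshold_seven_sixteen : (∀ γ, γ ≤ 7 → PhaseTorusLawN γ) ∧ (∀ γ, 16 ≤ γ → ¬ PhaseTorusLawN γ) :=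
  ⟨fun _ h => phaseTorusLawN_mono h phaseTorusLawN_seven, fun _ h => not_phaseTorusLawN_of_le h⟩

end Summit.Ventures.HSemireg.PhaseTorus
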